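import Mathlib
import Summits.Ventures.HodgeRepro0.P5S4TransportBasic
import Summits.Ventures.HodgeRepro0.P5S4Transport

/-!
# P8D4Transversal — ι-transversals of the (2,2,2,2) structure on 16 points (cell pub-hodge-repro0, seat p8 (g7))

Generic (group-independent) lemmas in the vocabulary of `P5S4Transport`, written for the Lean certificate of p7's finite
check on the order-8 D₄ configurations of the (2,2,2,2) block structure (P7-Dim8ARowsByHand v1.1 §5bis, STATUS l.2624 (iii),
lead l.2627 (2) / l.2692). Convention of p7's scripts: the point `pt(b, j, e) = 4b + 2e + j` (block `b`, pair `j`, position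
`e`), `ι` flips `e` (`x ↦ x xor 2`); the pair of a point is `P x = 2b + j`, its position bit `eb x = e`.

* `trans m c` — the ι-TRANSVERSAL with pair mask `m` (bit `p` set = the pair `p` is used) and choice vector `c` (bit `p` =
  the position chosen in pair `p`): one point per used pair, so `|trans m c| = popcnt m` (`card_trans`);
* `trans_of_noPair`: every set without an ι-pair (`x ∈ Δ → ι x ∉ Δ`) is `trans m c` for some `m, c < 256`;
* `cm_eq_trans`: every CM type (`IsCMType ι Φ`) is the full transversal `trans 255 φ` for some `φ < 256`;
* `balanced_pair` / `not_primitive_of_pair`: for `T` centralising `ι` and `Φ` a CM type, an ι-pair `{x, ι x}` is a balanced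
  2-set, so no set of more than two points containing an ι-pair is primitive;
* `inter_trans`: `trans m c ∩ trans 255 φ = trans (m &&& (255 ^^^ (c ^^^ φ))) c` — the intersection with a type is read off
  the masks;
* `smulF_trans`: for a permutation `t` whose inverse permutes the pairs by `pinv` with position flips `s`, and for 8-bit tables
  `PI`, `SIG` realising that action on masks and choice vectors, `t (trans m c) = trans (PI m) (SIG c)`.
Nothing is asserted about any group here; the tables and the check itself are in the certificate file.
-/

namespace HodgeRepro0.P8D4Transversal

open Finset HodgeRepro0.P5S4Transport

/-- the 16 points: `pt(b, j, e) = 4b + 2e + j` -/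
abbrev S := Fin 16

/-- an explicit permutation of the 16 points from its value table and the table of its inverse -/
def mkP (f g : S → S) (h1 : Function.LeftInverse g f) (h2 : Function.RightInverse g f) : Equiv.Perm S := ⟨f, g, h1, h2⟩

/-- complex conjugation `ι : x ↦ x xor 2` (flips the position `e` in every pair) -/
def ι : Equiv.Perm S :=
  mkP ![2, 3, 0, 1, 6, 7, 4, 5, 10, 11, 8, 9, 14, 15, 12, 13] ![2, 3, 0, 1, 6, 7, 4, 5, 10, 11, 8, 9, 14, 15, 12, 13]
    (by decide) (by decide)

/-- the pair `2b + j` of the point `4b + 2e + j` -/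
def P (x : S) : Fin 8 := ⟨2 * (x.val / 4) + x.val % 2, by omega⟩

/-- the position bit `e` of the point `4b + 2e + j` -/
def eb (x : S) : Bool := decide ((x.val / 2) % 2 = 1)

/-- the point of pair `p = 2b + j` at position `e` -/
def pt (p : Fin 8) (e : Bool) : S := ⟨4 * (p.val / 2) + 2 * (if e then 1 else 0) + p.val % 2, by split_ifs <;> omega⟩

/-- the block `b` of the point `4b + 2e + j` -/
def blk (x : S) : Fin 4 := ⟨x.val / 4, by omega⟩

/-- the pair of `pt p e` is `p` -/
theorem P_pt (p : Fin 8) (e : Bool) : P (pt p e) = p := by revert p e; decide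

/-- the position of `pt p e` is `e` -/
theorem eb_pt (p : Fin 8) (e : Bool) : eb (pt p e) = e := by revert p e; decide

/-- a point is the point of its pair at its position -/
theorem pt_P_eb (x : S) : pt (P x) (eb x) = x := by revert x; decide

/-- `ι` preserves the pairs -/
theorem P_iota (x : S) : P (ι x) = P x := by revert x; decide

/-- `ι` flips the position -/
theorem eb_iota (x : S) : eb (ι x) = !eb x := by revert x; decide

/-- `ι` has no fixed point -/
theorem iota_ne (x : S) : ι x ≠ x := by revert x; decide

/-- `ι` is an involution -/
theorem iota_inv : ι⁻¹ = ι := by decide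

/-- `ι ∘ ι = id` -/
theorem iota_iota (x : S) : ι (ι x) = x := by revert x; decide

/-- the block of a point is its pair index halved -/
theorem blk_P (x : S) : (blk x).val = (P x).val / 2 := by revert x; decide

/-- two points of the same pair are equal or ι-conjugate -/
theorem eq_or_eq_iota_of_P_eq {x y : S} (h : P x = P y) : y = x ∨ y = ι x := by
  revert x y; decide

/-- the number of bits set among the 8 low bits of `m` -/
def popcnt (m : ℕ) : ℕ := ((univ : Finset (Fin 8)).filter (fun p => m.testBit p.val = true)).card

/-- the popcounts of `0 … 255`, 4 bits each, as one 1024-bit literal -/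
def POPTBL : ℕ := 95125173855764218123276304889944061997689682402263585766959741291920687686033329201817409157123347502415384089435969498586180241031507595463600295898153685276653211633572815512294064538494957912327413386667662218713394765509704508661031522276467630197481635010039778342554499416459730172574551513689147646224

/-- popcount of an 8-bit value by table lookup (the fast form used inside the kernel checks) -/
def popcnt8 (m : ℕ) : ℕ := (POPTBL >>> (4 * m)) &&& 15

/-- the table popcount agrees with `popcnt` on `0 … 255` -/
theorem popcnt8_eq : ∀ m : Fin 256, popcnt8 m = popcnt m := by decide +kernel

/-- the table popcount agrees with `popcnt` below 256 -/
theorem popcnt8_eq_of_lt {m : ℕ} (hm : m < 256) : popcnt8 m = popcnt m := popcnt8_eq ⟨m, hm⟩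

/-- a bitwise AND with a value below 256 stays below 256 -/
theorem and_lt_256 {x y : ℕ} (hx : x < 256) : x &&& y < 256 := lt_of_le_of_lt (Nat.and_le_left) hx

/-- the ι-transversal of the pairs in `m`, choosing in pair `p` the position `testBit c p` -/
def trans (m c : ℕ) : Finset S :=
  ((univ : Finset (Fin 8)).filter (fun p => m.testBit p.val = true)).image (fun p => pt p (c.testBit p.val))

/-- membership in a transversal: the pair is used and the position is the chosen one -/
theorem mem_trans {m c : ℕ} {x : S} : x ∈ trans m c ↔ m.testBit (P x).val = true ∧ c.testBit (P x).val = eb x := by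
  unfold trans
  simp only [mem_image, mem_filter, mem_univ, true_and]
  constructor
  · rintro ⟨p, hp, rfl⟩
    rw [P_pt, eb_pt]
    exact ⟨hp, rfl⟩
  · rintro ⟨h1, h2⟩
    exact ⟨P x, h1, by rw [h2, pt_P_eb]⟩

/-- a transversal has one point per used pair -/
theorem card_trans (m c : ℕ) : (trans m c).card = popcnt m := by
  unfold trans popcnt
  rw [card_image_of_injOn]
  intro p _ q _ h
  have := congrArg P h
  rwa [P_pt, P_pt] at this

/-- restricting the pair mask gives a subset -/
theorem trans_subset_of_and (m w c : ℕ) : trans (m &&& w) c ⊆ trans m c := by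
  intro x hx
  rw [mem_trans] at hx ⊢
  obtain ⟨h1, h2⟩ := hx
  rw [Nat.testBit_and, Bool.and_eq_true] at h1
  exact ⟨h1.1, h2⟩

/-- every one of the 8 low bits of `255` is set -/
theorem testBit_255 (p : Fin 8) : (255 : ℕ).testBit p.val = true := by revert p; decide

/-- the intersection of a transversal with a full transversal (a type), read off the masks -/
theorem inter_trans (m c φ : ℕ) : trans m c ∩ trans 255 φ = trans (m &&& (255 ^^^ (c ^^^ φ))) c := by
  ext x
  rw [mem_inter, mem_trans, mem_trans, mem_trans, Nat.testBit_and, Nat.testBit_xor, Nat.testBit_xor, testBit_255]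
  generalize m.testBit (P x).val = a
  generalize c.testBit (P x).val = b
  generalize φ.testBit (P x).val = d
  generalize eb x = e
  revert a b d e; decide

/-- no ι-pair in a transversal -/
theorem not_iota_mem_trans {m c : ℕ} {x : S} (hx : x ∈ trans m c) : ι x ∉ trans m c := by
  rw [mem_trans] at hx ⊢
  rw [P_iota, eb_iota]
  rintro ⟨_, h⟩
  rw [hx.2] at h
  cases eb x <;> simp at h

/-- mask of a set of pairs -/
def maskOf (A : Finset (Fin 8)) : ℕ := ∑ p ∈ A, 2 ^ p.val

/-- the mask of a set of pairs is an 8-bit value -/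
theorem maskOf_lt (A : Finset (Fin 8)) : maskOf A < 256 := by revert A; decide +kernel

/-- the bits of the mask of a set of pairs -/
theorem testBit_maskOf (A : Finset (Fin 8)) (p : Fin 8) : (maskOf A).testBit p.val = decide (p ∈ A) := by
  revert A p; decide +kernel

/-- every set without an ι-pair is a transversal -/
theorem trans_of_noPair (Δ : Finset S) (h : ∀ x ∈ Δ, ι x ∉ Δ) :
    ∃ m c : ℕ, m < 256 ∧ c < 256 ∧ Δ = trans m c := by
  refine ⟨maskOf (Δ.image P), maskOf ((Δ.filter (fun y => eb y = true)).image P), maskOf_lt _, maskOf_lt _, ?_⟩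
  ext x
  rw [mem_trans, testBit_maskOf, testBit_maskOf]
  simp only [decide_eq_true_eq, mem_image, mem_filter]
  constructor
  · intro hx
    refine ⟨⟨x, hx, rfl⟩, ?_⟩
    cases he : eb x
    · simp only [decide_eq_false_iff_not, not_exists, not_and]
      rintro y ⟨hy, hey⟩ hP
      rcases eq_or_eq_iota_of_P_eq hP with rfl | rfl
      · rw [he] at hey; exact Bool.false_ne_true hey
      · exact h y hy hx
    · simp only [decide_eq_true_eq]
      exact ⟨x, ⟨hx, he⟩, rfl⟩
  · rintro ⟨⟨y, hy, hP⟩, hc⟩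
    rcases eq_or_eq_iota_of_P_eq hP with rfl | rfl
    · exact hy
    · exfalso
      rw [P_iota] at hP
      rw [eb_iota] at hc
      cases he : eb y
      · rw [he] at hc
        simp only [Bool.not_false, decide_eq_true_eq] at hc
        obtain ⟨z, ⟨hz, hez⟩, hPz⟩ := hc
        rcases eq_or_eq_iota_of_P_eq hPz with hzy | hzy
        · exact h y hy (hzy ▸ hz)
        · have hyz : y = z := ι.injective hzy
          rw [← hyz, he] at hez
          exact Bool.false_ne_true hez
      · rw [he] at hc
        simp only [Bool.not_true, decide_eq_false_iff_not, not_exists, not_and] at hc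
        exact hc y ⟨hy, he⟩ (P_iota y).symm

/-- a CM type has no ι-pair -/
theorem cm_noPair {Φ : Finset S} (hΦ : IsCMType ι Φ) : ∀ x ∈ Φ, ι x ∉ Φ := by
  intro x hx hιx
  have h1 : x ∈ smulF ι Φ := by rw [mem_smulF, iota_inv]; exact hιx
  exact Finset.disjoint_left.1 hΦ.1 hx h1

/-- a CM type has 8 points -/
theorem cm_card {Φ : Finset S} (hΦ : IsCMType ι Φ) : Φ.card = 8 := by
  have h1 : Φ ∪ smulF ι Φ = univ := by
    ext x; simp only [mem_union, mem_univ, iff_true]; exact hΦ.2 x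
  have h2 := card_union_of_disjoint hΦ.1
  rw [h1, card_smulF, card_univ, Fintype.card_fin] at h2
  omega

/-- an 8-bit mask with 8 bits set is `255` -/
theorem eq_255_of_popcnt {m : ℕ} (hm : m < 256) (h : popcnt m = 8) : m = 255 := by
  revert m; decide +kernel

/-- every CM type is a full transversal -/
theorem cm_eq_trans {Φ : Finset S} (hΦ : IsCMType ι Φ) : ∃ φ : ℕ, φ < 256 ∧ Φ = trans 255 φ := by
  obtain ⟨m, φ, hm, hφ, rfl⟩ := trans_of_noPair Φ (cm_noPair hΦ)
  have h8 := cm_card hΦ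
  rw [card_trans] at h8
  exact ⟨φ, hφ, by rw [eq_255_of_popcnt hm h8]⟩

/-- exactly one point of an ι-pair lies in a CM type -/
theorem card_pair_inter_cm {Φ : Finset S} (hΦ : IsCMType ι Φ) (y : S) : ({y, ι y} ∩ Φ).card = 1 := by
  have hne : y ≠ ι y := (iota_ne y).symm
  rcases hΦ.2 y with hy | hy
  · have h2 : ι y ∉ Φ := cm_noPair hΦ y hy
    have : ({y, ι y} : Finset S) ∩ Φ = {y} := by
      ext z
      simp only [mem_inter, mem_insert, mem_singleton]
      constructor
      · rintro ⟨h | h, hz⟩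
        · exact h
        · exact absurd (h ▸ hz) h2
      · rintro rfl; exact ⟨Or.inl rfl, hy⟩
    rw [this, card_singleton]
  · rw [mem_smulF, iota_inv] at hy
    have h2 : y ∉ Φ := fun hy' => cm_noPair hΦ y hy' hy
    have : ({y, ι y} : Finset S) ∩ Φ = {ι y} := by
      ext z
      simp only [mem_inter, mem_insert, mem_singleton]
      constructor
      · rintro ⟨h | h, hz⟩
        · exact absurd (h ▸ hz) h2
        · exact h
      · rintro rfl; exact ⟨Or.inr rfl, hy⟩
    rw [this, card_singleton]

/-- an ι-pair is a balanced 2-set for every `T` centralising `ι` and every CM type -/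
theorem balanced_pair (T : Finset (Equiv.Perm S)) (hT : ∀ t ∈ T, t * ι = ι * t) {Φ : Finset S}
    (hΦ : IsCMType ι Φ) (x : S) : Balanced T Φ 1 {x, ι x} := by
  refine ⟨by rw [card_pair (iota_ne x).symm], ?_⟩
  intro t ht
  have h1 : smulF t {x, ι x} = {t x, ι (t x)} := by
    have hc : t (ι x) = ι (t x) := by
      have := congrArg (fun u => u x) (hT t ht)
      simpa using this
    unfold smulF
    rw [map_insert, map_singleton]
    simp only [Equiv.toEmbedding_apply, hc]
  rw [h1]
  exact card_pair_inter_cm hΦ (t x)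

/-- a set of more than two points containing an ι-pair is not primitive -/
theorem not_primitive_of_pair (T : Finset (Equiv.Perm S)) (hT : ∀ t ∈ T, t * ι = ι * t) {Φ : Finset S}
    (hΦ : IsCMType ι Φ) {Δ : Finset S} (hΔ : 2 < Δ.card) {x : S} (hx : x ∈ Δ) (hιx : ι x ∈ Δ) (p : ℕ) :
    ¬ Primitive T Φ p Δ := by
  rintro ⟨_, h⟩
  have hsub : ({x, ι x} : Finset S) ⊂ Δ := by
    rw [Finset.ssubset_iff_subset_ne]
    refine ⟨?_, ?_⟩
    · intro z hz
      simp only [mem_insert, mem_singleton] at hz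
      rcases hz with rfl | rfl
      · exact hx
      · exact hιx
    · intro heq
      rw [← heq, card_pair (iota_ne x).symm] at hΔ
      exact lt_irrefl _ hΔ
  exact h {x, ι x} hsub ⟨x, mem_insert_self _ _⟩ 1 (balanced_pair T hT hΦ x)

/-- the image of a transversal under a permutation whose inverse acts on the pairs by `pinv` with position flips `s`,
given 8-bit tables `PI` (on masks) and `SIG` (on choice vectors) realising that action -/
theorem smulF_trans (t : Equiv.Perm S) (PI SIG : ℕ → ℕ) (pinv : Fin 8 → Fin 8) (s : Fin 8 → Bool)
    (hPI : ∀ m < 256, ∀ p : Fin 8, (PI m).testBit p.val = m.testBit (pinv p).val)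
    (hSIG : ∀ c < 256, ∀ p : Fin 8, (SIG c).testBit p.val = (c.testBit (pinv p).val ^^ s p))
    (hP : ∀ x : S, P (t⁻¹ x) = pinv (P x)) (hE : ∀ x : S, eb (t⁻¹ x) = (eb x ^^ s (P x)))
    {m c : ℕ} (hm : m < 256) (hc : c < 256) :
    smulF t (trans m c) = trans (PI m) (SIG c) := by
  ext x
  rw [mem_smulF, mem_trans, mem_trans, hPI m hm, hSIG c hc, hP, hE]
  generalize m.testBit (pinv (P x)).val = a
  generalize c.testBit (pinv (P x)).val = b
  generalize s (P x) = d
  generalize eb x = e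
  revert a b d e; decide

/-- the block of `pt p e` is `p / 2` -/
theorem blk_pt (p : Fin 8) (e : Bool) : (blk (pt p e)).val = p.val / 2 := by revert p e; decide

/-- the number of used pairs of `m` in block `b` -/
def blkcnt (m : ℕ) (b : Fin 4) : ℕ :=
  ((univ : Finset (Fin 8)).filter (fun p => m.testBit p.val = true ∧ p.val / 2 = b.val)).card

/-- the block profile of a transversal, read off its pair mask -/
theorem prof_trans (m c : ℕ) (b : Fin 4) : prof blk (trans m c) b = blkcnt m b := by
  unfold prof trans blkcnt
  rw [filter_image, card_image_of_injOn]
  · congr 1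
    ext p
    simp only [mem_filter, mem_univ, true_and]
    constructor
    · rintro ⟨h1, h2⟩
      refine ⟨h1, ?_⟩
      have := congrArg Fin.val h2
      rwa [blk_pt] at this
    · rintro ⟨h1, h2⟩
      refine ⟨h1, Fin.ext ?_⟩
      rw [blk_pt, h2]
  · intro p _ q _ h
    have := congrArg P h
    rwa [P_pt, P_pt] at this

/-- a six-pair mask with an empty block is one of the four masks `63, 207, 243, 252` (pairs `2b, 2b+1` in block `b`) -/
theorem mask_2220 : ∀ m : Fin 256, popcnt m = 6 → (∃ b : Fin 4, blkcnt m b = 0) →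
    (m : ℕ) = 63 ∨ (m : ℕ) = 207 ∨ (m : ℕ) = 243 ∨ (m : ℕ) = 252 := by
  decide +kernel

/-- `255 &&& w = w` for an 8-bit value -/
theorem and_255_eq : ∀ w : Fin 256, 255 &&& (w : ℕ) = w := by decide +kernel

/-- `255 &&& w = w` below 256 -/
theorem and_255_of_lt {w : ℕ} (hw : w < 256) : 255 &&& w = w := and_255_eq ⟨w, hw⟩

/-- a sub-mask `w < 256` gives a subset of the full transversal -/
theorem trans_subset_255 {w : ℕ} (hw : w < 256) (c : ℕ) : trans w c ⊆ trans 255 c := by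
  have := trans_subset_of_and 255 w c
  rwa [and_255_of_lt hw] at this

end HodgeRepro0.P8D4Transversal
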